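import Mathlib
import HarnessLib
import Literature.MathematicalPhysics.StatisticalMechanics.ReblockingNeighbourhoods
import Literature.MathematicalPhysics.StatisticalMechanics.DiscreteTaylorFields

/-!
# The thickened block `B* = B + [−r, r]^d` is a box: `B* = a + [0, ρ']^d` with
# `a = c(B) − (h + r)·𝟙`, `ρ' = 2(h + r)` (`s = 2h + 1`)

Lemma 8.9 / Lemma 10.3 of [ABKM19] are stated for a gauge set `S = {x : InBox a ρ' x}` containing the
block `B` with room for the test polynomials (`RelevantProjectionContraction.tayNorm_Pi2Rem_le`,
`LinearisedMapSingleBlock`).  For the norms of (6.40)–(6.47) the gauge set of a single block is its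
small-set neighbourhood `B* = thicken r B`.  This file identifies the two on the odd torus
`(ℤ/M)^d`, `M = s·t`, for cubes that do not wrap around (`4(h + r) < M`):

* `mem_blockOf_iff_supNorm_sub_blockCenter_le` — `y ∈ B_x ↔ |y − c(B_x)|_∞ ≤ h`;
* `mem_thicken_blockOf_iff_supNorm_le` — `z ∈ B_x + [−r,r]^d ↔ |z − c(B_x)|_∞ ≤ h + r`;
* `boxCorner s r x = c(B_x) − (h + r)𝟙`, **`mem_thicken_blockOf_iff_inBox`** —
  `z ∈ thicken r B_x ↔ InBox (boxCorner s r x) (2(h+r)) z`;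
* `inBox_self`, `hasRoom_of_inBox`, `boxCorner_eq_add` (the corner moves with the block centre).

Everything here is proved; no named fact.

## References
* S. Adams, S. Buchholz, R. Kotecký, S. Müller, arXiv:1910.13564, Ch. 6.2 (6.25)–(6.27), Lemma 8.9
  (the gauge set of a block) [AdamsBuchholzKoteckyMuller2019].
-/

noncomputable section

namespace Literature.MathematicalPhysics.StatisticalMechanics.TorusPolymer

open Finset
open Literature.MathematicalPhysics.StatisticalMechanics.GradientRG (InBox HasRoom relCoord)

variable {d M : ℕ} [NeZero M]

/-! ## Blocks and thickened blocks as sup-norm cubes about the block centre -/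

/-- **`y ∈ B_x ↔ |y − c(B_x)|_∞ ≤ h`** (`s = 2h+1`, odd torus `M = s·t`).
[cite: AdamsBuchholzKoteckyMuller2019, Ch. 6.2] -/
theorem mem_blockOf_iff_supNorm_sub_blockCenter_le {s t : ℕ} (hM : M = s * t) (hs : Odd s) (ht : Odd t)
    (x y : Fin d → ZMod M) :
    y ∈ blockOf s x ↔ GradientFRD.supNorm (y - blockCenter s x) ≤ (s - 1) / 2 := by
  constructor
  · intro hy
    rw [blockCenter_eq_of_sameBlock (mem_blockOf.1 hy)]
    exact supNorm_sub_blockCenter_le hM hs ht y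
  · exact mem_blockOf_of_supNorm_sub_le hM hs ht

/-- **`z ∈ B_x + [−r,r]^d ↔ |z − c(B_x)|_∞ ≤ h + r`** when the cube does not wrap
(`2(h + r) + 1 ≤ M`... we assume `4(h+r) < M`). [cite: AdamsBuchholzKoteckyMuller2019, Ch. 6.2 (6.25)] -/
theorem mem_thicken_blockOf_iff_supNorm_le {s t r : ℕ} (hM : M = s * t) (hs : Odd s) (ht : Odd t)
    (hwrap : 4 * ((s - 1) / 2 + r) < M) (x z : Fin d → ZMod M) :
    z ∈ thicken r (blockOf s x) ↔ GradientFRD.supNorm (z - blockCenter s x) ≤ (s - 1) / 2 + r := by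
  set c := blockCenter s x with hc
  set h := (s - 1) / 2 with hh
  constructor
  · intro hz
    obtain ⟨y, hy, hzy⟩ := mem_thicken.1 hz
    have hyc := (mem_blockOf_iff_supNorm_sub_blockCenter_le hM hs ht x y).1 hy
    rw [← hc] at hyc
    have := supNorm_sub_le z y c
    omega
  · intro hz
    rw [supNorm_le_iff] at hz
    -- clamp the offset of `z` to `[−h, h]` coordinatewise
    set δ : Fin d → ℤ := fun i => ((z - c) i).valMinAbs with hδ
    set κ : Fin d → ℤ := fun i => max (-(h : ℤ)) (min (h : ℤ) (δ i)) with hκ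
    have hκabs : ∀ i, |κ i| ≤ h := fun i => by
      rw [abs_le]; simp only [hκ]; constructor
      · exact le_max_left _ _
      · exact max_le (by omega) (min_le_left _ _)
    have hδκ : ∀ i, |δ i - κ i| ≤ r := fun i => by
      have hzi : ((δ i).natAbs : ℤ) ≤ (h : ℤ) + r := by exact_mod_cast hz i
      rw [Int.natCast_natAbs] at hzi
      rw [abs_le] at hzi ⊢
      simp only [hκ]
      rcases le_total (δ i) (h : ℤ) with h1 | h1
      · rw [min_eq_right h1]
        rcases le_total (-(h : ℤ)) (δ i) with h2 | h2
        · rw [max_eq_right h2]; constructor <;> omega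
        · rw [max_eq_left h2]; constructor <;> omega
      · rw [min_eq_left h1, max_eq_right (by omega)]; constructor <;> omega
    have hMh : (h : ℤ) ≤ ((M : ℤ) - 1) / 2 := by omega
    have hMr : (r : ℤ) ≤ ((M : ℤ) - 1) / 2 := by omega
    set y : Fin d → ZMod M := fun i => c i + ((κ i : ℤ) : ZMod M) with hy
    refine mem_thicken.2 ⟨y, ?_, ?_⟩
    · refine mem_blockOf_of_supNorm_sub_le hM hs ht ?_
      rw [supNorm_le_iff]
      intro i
      have e : (y - c) i = ((κ i : ℤ) : ZMod M) := by simp [hy]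
      rw [e, valMinAbs_intCast_of_abs_le ((hκabs i).trans hMh)]
      have := hκabs i
      rw [abs_le] at this
      omega
    · rw [supNorm_le_iff]
      intro i
      have e : (z - y) i = (((δ i - κ i : ℤ)) : ZMod M) := by
        have : (z - y) i = (z - c) i - ((κ i : ℤ) : ZMod M) := by simp [hy]; ring
        rw [this, Int.cast_sub, ← ZMod.coe_valMinAbs ((z - c) i)]
      rw [e, valMinAbs_intCast_of_abs_le ((hδκ i).trans hMr)]
      have := hδκ i
      rw [abs_le] at this
      omega

/-! ## The box form -/

/-- The lower corner `a = c(B_x) − (h + r)𝟙` of the cube `B_x + [−r,r]^d`.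
[cite: AdamsBuchholzKoteckyMuller2019, Lemma 8.9 (the box S ⊇ B)] -/
def boxCorner (s r : ℕ) (x : Fin d → ZMod M) : Fin d → ZMod M :=
  fun i => blockCenter s x i - (((s - 1) / 2 + r : ℕ) : ZMod M)

omit [NeZero M] in
/-- The corner moves with the block centre: `a(B_y) = a(B_{x₀}) + (c(B_y) − c(B_{x₀}))`.
[cite: AdamsBuchholzKoteckyMuller2019, Ch. 6.2] -/
theorem boxCorner_eq_add (s r : ℕ) (x₀ y : Fin d → ZMod M) :
    boxCorner s r y = boxCorner s r x₀ + (blockCenter s y - blockCenter s x₀) := by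
  funext i; simp only [boxCorner, Pi.add_apply, Pi.sub_apply]; ring

/-- **`B_x + [−r,r]^d = a + [0, 2(h+r)]^d`**, `a = boxCorner s r x`, when `4(h + r) < M`.
[cite: AdamsBuchholzKoteckyMuller2019, Lemma 8.9 (the box S ⊇ B)] -/
theorem mem_thicken_blockOf_iff_inBox {s t r : ℕ} (hM : M = s * t) (hs : Odd s) (ht : Odd t)
    (hwrap : 4 * ((s - 1) / 2 + r) < M) (x z : Fin d → ZMod M) :
    z ∈ thicken r (blockOf s x) ↔ InBox (boxCorner s r x) (2 * ((s - 1) / 2 + r)) z := by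
  rw [mem_thicken_blockOf_iff_supNorm_le hM hs ht hwrap, supNorm_le_iff]
  set c := blockCenter s x with hc
  set H : ℕ := (s - 1) / 2 + r with hH
  have hMH : (2 * H : ℤ) ≤ ((M : ℤ) - 1) / 2 := by omega
  have key : ∀ i, z i - boxCorner s r x i = (((((z - c) i).valMinAbs + H : ℤ)) : ZMod M) := by
    intro i
    rw [Int.cast_add, ZMod.coe_valMinAbs]
    simp only [boxCorner, Pi.sub_apply, ← hc, ← hH]
    push_cast; ring
  constructor
  · intro hz i
    have hzi : (((z - c) i).valMinAbs.natAbs : ℤ) ≤ H := by exact_mod_cast hz i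
    rw [Int.natCast_natAbs, abs_le] at hzi
    have habs : |((z - c) i).valMinAbs + H| ≤ ((M : ℤ) - 1) / 2 := by rw [abs_le]; omega
    rw [relCoord, key i, valMinAbs_intCast_of_abs_le habs]
    constructor <;> push_cast <;> omega
  · intro hz i
    obtain ⟨h0, h1⟩ := hz i
    rw [relCoord, key i] at h0 h1
    -- `(z - c) i` is the cast of `ρ − H` with `ρ = relCoord ∈ [0, 2H]`
    set ρ : ℤ := ((((((z - c) i).valMinAbs + H : ℤ)) : ZMod M)).valMinAbs with hρ
    have e : (z - c) i = (((ρ - H : ℤ)) : ZMod M) := by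
      have h1 : ((ρ : ℤ) : ZMod M) = (((((z - c) i).valMinAbs + H : ℤ)) : ZMod M) := by
        rw [hρ, ZMod.coe_valMinAbs]
      rw [Int.cast_sub, h1, Int.cast_add, ZMod.coe_valMinAbs]
      push_cast; ring
    have habs : |ρ - H| ≤ ((M : ℤ) - 1) / 2 := by
      rw [abs_le]; push_cast at h1; omega
    have : ((z - c) i).valMinAbs = ρ - H := by rw [e, valMinAbs_intCast_of_abs_le habs]
    have hle : |ρ - (H : ℤ)| ≤ H := by rw [abs_le]; push_cast at h1; omega
    have : (((z - c) i).valMinAbs.natAbs : ℤ) ≤ H := by rw [Int.natCast_natAbs, this]; exact hle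
    exact_mod_cast this

omit [NeZero M] in
/-- The corner lies in its own box. [cite: AdamsBuchholzKoteckyMuller2019, Lemma 8.9] -/
theorem inBox_self (a : Fin d → ZMod M) (ρ' : ℕ) : InBox a ρ' a := fun i => by
  simp [GradientRG.relCoord_self]

omit [NeZero M] in
/-- Points of the box have room for `n` more steps when `2(ρ' + n) < M`.
[cite: AdamsBuchholzKoteckyMuller2019, Lemma 8.9] -/
theorem hasRoom_of_inBox {a z : Fin d → ZMod M} {ρ' n : ℕ} (hz : InBox a ρ' z)
    (hM : ((ρ' : ℤ) + n) * 2 < M) : HasRoom a z n := fun i => by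
  obtain ⟨h0, h1⟩ := hz i
  rw [abs_of_nonneg h0]
  nlinarith

end Literature.MathematicalPhysics.StatisticalMechanics.TorusPolymer

end
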